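import Summits.QuantumFields.BalabanUV.T4Continuum.Support.NE9LinSizeCurrencyBudgetKP
import Literature.MathematicalPhysics.QuantumFieldTheory.Balaban1983to89.T4HistoryLipschitzSegment

/-!
# NE9LinSizeEndBudget — N2-ter §C: the budget ON THE d-CURRENCY END FACE E5′ LITERALLY
(`NE9LinSizeEnd.torus_termSize_ne9_and_fadingMemory_of_linSizeDischargers(_of_dLe)`, p209889): its scalar binders `hrate`, `hsmall`,
`hκa`, `hliplb`, `hlipb` and its rate letter `μ = ω + 4·lipbar·(a₁·e^{−a″(ν+1)})·τ̄` copied TOKEN FOR TOKEN; N2-ter §B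
(`NE9LinSizeCurrencyBudgetKP`, binder shapes of parts 1b ∕ B-i) instantiated at E5′'s display (`ε ↦ 2ε′`, `a₁ ↦ a₁ + log 2` in the
exponent and in the rate condition), plus the `fade_iff` anchor on `μ` asked for by the (w6) lineage (journal l.7183, finding
F-ne9leaf10g2-1) — cell `pub-balaban`, node U3 ∕ spine estimate NE9, rung (B)+1 on a FIXED finite T⁴; unit
`b2b-balaban-t4-ne9-formalise-leaf-01` gen 2.

HONEST FRAMING (T4-DAG PAGE 1).  Rung (B)+1 on a fixed finite torus; NOT infinite volume, NOT the mass gap, NOT Clay.  NE9 is NOT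
PRINTED and NOT proved; this module is OUR OWN bookkeeping (pure real arithmetic on displayed binder shapes), asserts nothing about
Bałaban's objects, re-wires no END face and introduces no `def`.  HONEST DEPENDENCY: continuum YM on T⁴ ⇐ BetaPertH ∧ nine spine
estimates (0/9 proved); BetaPertH ⇐ (D1) ∧ (D4) ∧ CAP+tail; G-an2-4 gates asym, D1 and NE2/3/4.

WHAT IS RECORDED (E5′'s letters: `ν` torus dimension, `D` adjacency degree, `a′` the (2.38)-TYPE d-rate of the box majorant, `a″` the
decay-weight rate, `a₁` the KP size constant, `ε′ k` the majorant scale, `α4 k` the (2.20)-TYPE table scale, `lip k ≤ lipbar`, `τ̄`, `ω`):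
§1 (R′ on E5′) `hrate ∧ hκa ⇒ κ ≤ a′ − (2^ν log 2 + log 8ν) − 2^ν(a₁ + log 2)` — ADDITIVE; T⁴: `κ ≤ a′ − 37·log 2 − 16a₁ (> a′ − 25.65 − 16a₁)`;
   print's letters (located `a′ = (L+8)κ/10`): the FULL printed rate at `L = 13` for every `κ ≥ 23.33 + (160/11)a₁` (§B `full_rate_L13_shifted`).
§2 (P′ on E5′) `hsmall ⇒ B := a₁e^{−a″(ν+1)} ≥ 2(D+1)·2^(ν+1+2^ν)·2^(2^ν)·e^{2^ν a₁}·ε′` (the `e^{a″(ν+1)}` — print's `e^{5κ}` — CANCELS);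
   `μ − ω = 4·lipbar·B·τ̄ ≥ 8(D+1)·2^(2^ν)·(2^(ν+1+2^ν))²·e^{2^ν a₁}·α4·ε′·τ̄`; fading (`μ < 1`) REQUIRES the POLYNOMIAL smallness
   `8(D+1)·2^(2^ν)·(2^(ν+1+2^ν))²·α4·ε′·τ̄ < 1 − ω` (T⁴: `72·2^58·α4·ε′·τ̄ < 1 − ω`), and is IMPLIED, jointly with `hsmall`∕`hliplb`∕`hlipb`∕
   `hpos`, by `8e(D+1)·2^(2^ν)·(2^(ν+1+2^ν))²·α4·ε′·τ̄ < 1 − ω` plus the print-SHAPED KP smallness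
   `2^{ν+1}e(D+1)·2^(2^ν)·2^(ν+1+2^ν)·ε′·e^{a″(ν+1)} ≤ 1` («2E₀ε₁C₁α₄⁻¹α₆⁻¹M^q exp C₂κ₁ exp 5κ ≤ 1», [II] p. 18; `ν + 1 = 5`).
§3 the `fade_iff` ANCHOR (reading F-ne9leaf10g2-1 of the (w6) lineage, kernel form): `μ < 1 ↔ 4·lipbar·a₁·τ̄·e^{−a″(ν+1)} < 1 − ω ↔
   log(4·lipbar·a₁·τ̄/(1 − ω)) < a″(ν+1)` (for a positive product and `ω < 1`) — at FIXED `a₁`, fading is a LOWER bound on `a″`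
   (TYPE «κ sufficiently large»), `μ` antitone in `a″`; the two readings agree: §3 fixes `a₁` and pays `hsmall` as the
   `ε′e^{a″(ν+1)}`-smallness, §2 takes `a₁` at the floor `hsmall` allows and reads the product as polynomial in `ε′`.
Nothing here is a claim about Bałaban's activities; which face (cube-count E2∕E5, half-repaired E5″, d-currency E5′) an instantiation
uses is decided by O-NE9-1.

References (TYPE locators only; nothing printed is a hypothesis): T. Bałaban, CMP **116** (1988) [Balaban1988RG2Cluster] (1.26) p. 8,
(2.27), (2.29)–(2.30) p. 18, p. 18 «exp 5κ ≤ 1», Lemma 3 (2.38) p. 20, (2.40)–(2.41) p. 21; CMP **109** (1987) [Balaban1987RG1] Thm 3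
«κ ≥ κ₀» p. 264, p. 251, p. 257.
-/

noncomputable section

namespace Summit.QuantumFields.BalabanUV.T4Continuum.NE9LinSizeEndBudget

open Real
open Literature.MathematicalPhysics.QuantumFieldTheory.Balaban1983to89.T4HistoryLipschitzSegment (fade_iff)
open Summit.QuantumFields.BalabanUV.T4Continuum.NE9LinSizeCurrencyBudgetKP
  (rate_budget_lin envelope_lb full_rate_L13_shifted)

/-! ## §0 `e^{2^ν·log 2} = 2^(2^ν)`: the absorbed volume factor of E5′'s display -/

/-- `exp (2^ν·(a₁ + log 2)) = exp (2^ν·a₁)·2^(2^ν)`. [folklore] -/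
theorem exp_two_pow_mul_add_log_two (ν : ℕ) (a₁ : ℝ) :
    Real.exp (2 ^ ν * (a₁ + Real.log 2)) = Real.exp (2 ^ ν * a₁) * (2:ℝ) ^ (2 ^ ν) := by
  have h : (2:ℝ) ^ (2 ^ ν) = Real.exp ((2:ℝ) ^ ν * Real.log 2) := by
    rw [← Real.rpow_natCast, Real.rpow_def_of_pos (by norm_num : (0:ℝ) < 2)]
    congr 1; push_cast; ring
  rw [h, ← Real.exp_add]
  congr 1; ring

/-! ## §1 (R′) on E5′: the additive rate budget -/

/-- **(R′) ON E5′ (kernel).**  E5′'s `hrate : 2^ν·log 2 + log(8ν) ≤ a′ − a″ − 2^ν·(a₁ + log 2)` and `hκa : κ ≤ a″` give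
`κ ≤ a′ − (2^ν·log 2 + log 8ν) − 2^ν·(a₁ + log 2)` — ADDITIVE in `a′` (§B `rate_budget_lin` at `a₁ ↦ a₁ + log 2`). [folklore] -/
theorem rate_budget_E5' {ν : ℕ} {a' a'' a₁ κ : ℝ}
    (hrate : (2:ℝ) ^ ν * Real.log 2 + Real.log (8 * ν) ≤ a' - a'' - 2 ^ ν * (a₁ + Real.log 2)) (hκa : κ ≤ a'') :
    κ ≤ a' - ((2:ℝ) ^ ν * Real.log 2 + Real.log (8 * ν)) - 2 ^ ν * (a₁ + Real.log 2) :=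
  rate_budget_lin hrate hκa

/-- **(R′) ON E5′, T⁴** (`ν = 4`): `κ ≤ a′ − 37·log 2 − 16·a₁` (`16·log 2 + log 32 + 16·log 2 = 37·log 2`). [folklore] -/
theorem rate_budget_E5'_T4 {a' a'' a₁ κ : ℝ}
    (hrate : (2:ℝ) ^ (4:ℕ) * Real.log 2 + Real.log (8 * ((4:ℕ):ℝ)) ≤ a' - a'' - 2 ^ (4:ℕ) * (a₁ + Real.log 2))
    (hκa : κ ≤ a'') : κ ≤ a' - 37 * Real.log 2 - 16 * a₁ := by
  have h32 : Real.log (8 * ((4:ℕ):ℝ)) = 5 * Real.log 2 := by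
    rw [show (8 * ((4:ℕ):ℝ)) = 2 ^ 5 by norm_num, Real.log_pow]; norm_num
  have e : (2:ℝ) ^ (4:ℕ) = 16 := by norm_num
  rw [h32, e] at hrate
  linarith

/-- the attained T⁴ value exceeds `a′ − 25.65 − 16a₁` (`37·log 2 < 25.65`). [folklore] -/
theorem budget_E5'_T4_gt (a' a₁ : ℝ) : a' - 25.65 - 16 * a₁ < a' - 37 * Real.log 2 - 16 * a₁ := by
  have := Real.log_two_lt_d9
  linarith

/-- **(R′) ON E5′ IN PRINT'S LETTERS, `L = 13`** (located `a′ = (L+8)κ/10 = 2.1κ`): the FULL printed rate fits E5′'s budget for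
every `κ ≥ 23.33 + (160/11)·a₁` — against «L ≥ 152» of the cube-count faces (N2-bis `rate_fraction_ge_one_iff`). [folklore] -/
theorem full_rate_E5'_L13 {κ a₁ : ℝ} (hκ : 23.33 + 160 / 11 * a₁ ≤ κ) :
    κ ≤ (13 + 8) / 10 * κ - 37 * Real.log 2 - 16 * a₁ := by
  have h := full_rate_L13_shifted hκ
  linarith

/-! ## §2 (P′) on E5′: the fading product is polynomial in `ε′` -/

/-- **THE PIN ENVELOPE OF E5′ FROM ITS `hsmall` (kernel).**  `hsmall : (D+1)·(2ε′)·e^{a″(ν+1) + 2^ν(a₁ + log 2)}·2^(ν+1+2^ν) ≤ a₁`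
gives `2(D+1)·2^(ν+1+2^ν)·2^(2^ν)·e^{2^ν a₁}·ε′ ≤ a₁·e^{−a″(ν+1)}` — the `e^{a″(ν+1)}` cancels against the envelope. [folklore] -/
theorem envelope_lb_E5' {ν D : ℕ} {a'' a₁ ε' : ℝ}
    (hsmall : ((D : ℝ) + 1) * (2 * ε') * Real.exp (a'' * (ν + 1) + 2 ^ ν * (a₁ + Real.log 2)) *
      2 ^ (ν + 1 + 2 ^ ν) ≤ a₁) :
    2 * ((D : ℝ) + 1) * 2 ^ (ν + 1 + 2 ^ ν) * (2:ℝ) ^ (2 ^ ν) * Real.exp (2 ^ ν * a₁) * ε' ≤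
      a₁ * Real.exp (-(a'' * (ν + 1))) := by
  have h := @envelope_lb ν D a'' a₁ (2 * ε') (2 ^ ν * (a₁ + Real.log 2)) 1 (by rw [one_mul]; exact hsmall)
  rw [one_mul, exp_two_pow_mul_add_log_two] at h
  calc 2 * ((D : ℝ) + 1) * 2 ^ (ν + 1 + 2 ^ ν) * (2:ℝ) ^ (2 ^ ν) * Real.exp (2 ^ ν * a₁) * ε'
      = ((D : ℝ) + 1) * 2 ^ (ν + 1 + 2 ^ ν) * (Real.exp (2 ^ ν * a₁) * (2:ℝ) ^ (2 ^ ν)) * (2 * ε') := by ring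
    _ ≤ a₁ * Real.exp (-(a'' * (ν + 1))) := h

/-- **(P′) ON E5′: THE FADING PRODUCT (kernel).**  With E5′'s `hliplb : α4·2^(ν+1+2^ν) ≤ lip`, `hlipb : lip ≤ lipbar` (one `k`) and
`hsmall`:  `8(D+1)·2^(2^ν)·(2^(ν+1+2^ν))²·e^{2^ν a₁}·α4·ε′·τ̄ ≤ 4·lipbar·(a₁·e^{−a″(ν+1)})·τ̄ = μ − ω` — NO `e^{κ}`, `e^{a}`, `e^{a′}`,
`e^{a″}`. [folklore] -/
theorem fadingProduct_lb_E5' {ν D : ℕ} {a'' a₁ ε' α4 lip lipbar τbar : ℝ} (hα4 : 0 ≤ α4) (hε' : 0 ≤ ε')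
    (hτbar : 0 ≤ τbar) (hliplb : α4 * 2 ^ (ν + 1 + 2 ^ ν) ≤ lip) (hlipb : lip ≤ lipbar)
    (hsmall : ((D : ℝ) + 1) * (2 * ε') * Real.exp (a'' * (ν + 1) + 2 ^ ν * (a₁ + Real.log 2)) *
      2 ^ (ν + 1 + 2 ^ ν) ≤ a₁) :
    8 * ((D : ℝ) + 1) * (2:ℝ) ^ (2 ^ ν) * (2 ^ (ν + 1 + 2 ^ ν)) ^ 2 * Real.exp (2 ^ ν * a₁) * α4 * ε' * τbar ≤
      4 * lipbar * (a₁ * Real.exp (-(a'' * (ν + 1)))) * τbar := by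
  have h1 : α4 * 2 ^ (ν + 1 + 2 ^ ν) ≤ lipbar := hliplb.trans hlipb
  have h2 := envelope_lb_E5' hsmall
  have hx : 0 ≤ α4 * 2 ^ (ν + 1 + 2 ^ ν) := by positivity
  have hy : 0 ≤ 2 * ((D : ℝ) + 1) * 2 ^ (ν + 1 + 2 ^ ν) * (2:ℝ) ^ (2 ^ ν) * Real.exp (2 ^ ν * a₁) * ε' := by
    positivity
  have h12 := mul_le_mul h1 h2 hy (hx.trans h1)
  calc 8 * ((D : ℝ) + 1) * (2:ℝ) ^ (2 ^ ν) * (2 ^ (ν + 1 + 2 ^ ν)) ^ 2 * Real.exp (2 ^ ν * a₁) * α4 * ε' * τbar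
      = 4 * (α4 * 2 ^ (ν + 1 + 2 ^ ν) *
          (2 * ((D : ℝ) + 1) * 2 ^ (ν + 1 + 2 ^ ν) * (2:ℝ) ^ (2 ^ ν) * Real.exp (2 ^ ν * a₁) * ε')) * τbar := by ring
    _ ≤ 4 * (lipbar * (a₁ * Real.exp (-(a'' * (ν + 1))))) * τbar :=
        mul_le_mul_of_nonneg_right (mul_le_mul_of_nonneg_left h12 (by norm_num)) hτbar
    _ = 4 * lipbar * (a₁ * Real.exp (-(a'' * (ν + 1)))) * τbar := by ring

/-- **(P′) ON E5′ AS A NECESSARY CONDITION: polynomial smallness.**  `μ < 1` REQUIRES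
`8(D+1)·2^(2^ν)·(2^(ν+1+2^ν))²·α4·ε′·τ̄ < 1 − ω`. [folklore] -/
theorem fade_necessary_E5' {ν D : ℕ} {a'' a₁ ε' α4 lip lipbar τbar ω : ℝ} (hα4 : 0 ≤ α4) (hε' : 0 ≤ ε')
    (hτbar : 0 ≤ τbar) (ha₁ : 0 ≤ a₁) (hliplb : α4 * 2 ^ (ν + 1 + 2 ^ ν) ≤ lip) (hlipb : lip ≤ lipbar)
    (hsmall : ((D : ℝ) + 1) * (2 * ε') * Real.exp (a'' * (ν + 1) + 2 ^ ν * (a₁ + Real.log 2)) *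
      2 ^ (ν + 1 + 2 ^ ν) ≤ a₁)
    (hfade : ω + 4 * lipbar * (a₁ * Real.exp (-(a'' * (ν + 1)))) * τbar < 1) :
    8 * ((D : ℝ) + 1) * (2:ℝ) ^ (2 ^ ν) * (2 ^ (ν + 1 + 2 ^ ν)) ^ 2 * α4 * ε' * τbar < 1 - ω := by
  have h := fadingProduct_lb_E5' hα4 hε' hτbar hliplb hlipb hsmall
  have hE : 1 ≤ Real.exp (2 ^ ν * a₁) := Real.one_le_exp (by positivity)
  have hc : 0 ≤ 8 * ((D : ℝ) + 1) * (2:ℝ) ^ (2 ^ ν) * (2 ^ (ν + 1 + 2 ^ ν)) ^ 2 * α4 * ε' * τbar := by positivity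
  have hmono : 8 * ((D : ℝ) + 1) * (2:ℝ) ^ (2 ^ ν) * (2 ^ (ν + 1 + 2 ^ ν)) ^ 2 * α4 * ε' * τbar ≤
      8 * ((D : ℝ) + 1) * (2:ℝ) ^ (2 ^ ν) * (2 ^ (ν + 1 + 2 ^ ν)) ^ 2 * Real.exp (2 ^ ν * a₁) * α4 * ε' * τbar := by
    calc 8 * ((D : ℝ) + 1) * (2:ℝ) ^ (2 ^ ν) * (2 ^ (ν + 1 + 2 ^ ν)) ^ 2 * α4 * ε' * τbar
        = (8 * ((D : ℝ) + 1) * (2:ℝ) ^ (2 ^ ν) * (2 ^ (ν + 1 + 2 ^ ν)) ^ 2 * α4 * ε' * τbar) * 1 := (mul_one _).symm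
      _ ≤ (8 * ((D : ℝ) + 1) * (2:ℝ) ^ (2 ^ ν) * (2 ^ (ν + 1 + 2 ^ ν)) ^ 2 * α4 * ε' * τbar) *
            Real.exp (2 ^ ν * a₁) := mul_le_mul_of_nonneg_left hE hc
      _ = _ := by ring
  linarith

/-- **(P′) ON E5′, T⁴** (`ν = 4`, `D = 8`): fading requires `72·2^58·α4·ε′·τ̄ < 1 − ω` (`8·9·2^16·2^42`). [folklore] -/
theorem fade_necessary_E5'_T4 {a'' a₁ ε' α4 lip lipbar τbar ω : ℝ} (hα4 : 0 ≤ α4) (hε' : 0 ≤ ε')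
    (hτbar : 0 ≤ τbar) (ha₁ : 0 ≤ a₁)
    (hliplb : α4 * 2 ^ ((4:ℕ) + 1 + 2 ^ (4:ℕ)) ≤ lip) (hlipb : lip ≤ lipbar)
    (hsmall : ((((8:ℕ) : ℝ)) + 1) * (2 * ε') * Real.exp (a'' * ((4:ℕ) + 1) + 2 ^ (4:ℕ) * (a₁ + Real.log 2)) *
      2 ^ ((4:ℕ) + 1 + 2 ^ (4:ℕ)) ≤ a₁)
    (hfade : ω + 4 * lipbar * (a₁ * Real.exp (-(a'' * ((4:ℕ) + 1)))) * τbar < 1) :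
    72 * 2 ^ 58 * α4 * ε' * τbar < 1 - ω := by
  have h := fade_necessary_E5' (ν := 4) (D := 8) hα4 hε' hτbar ha₁ hliplb hlipb hsmall hfade
  have e : (8:ℝ) * (((8:ℕ) : ℝ) + 1) * (2:ℝ) ^ (2 ^ (4:ℕ)) * ((2:ℝ) ^ ((4:ℕ) + 1 + 2 ^ (4:ℕ))) ^ 2 = 72 * 2 ^ 58 := by
    norm_num
  rw [e] at h
  exact h

/-- **(P′) ON E5′ — SUFFICIENCY (kernel).**  Under the print-SHAPED KP smallness `2^{ν+1}e(D+1)·2^(2^ν)·2^(ν+1+2^ν)·ε′·e^{a″(ν+1)} ≤ 1`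
(«… exp 5κ ≤ 1», p. 18; `ν + 1 = 5` on T⁴) and the POLYNOMIAL product condition `8e(D+1)·2^(2^ν)·(2^(ν+1+2^ν))²·α4·ε′·τ̄ < 1 − ω`,
the choices `a₁ := 2e(D+1)·2^(2^ν)·2^(ν+1+2^ν)·ε′·e^{a″(ν+1)}`, `lip = lipbar := α4·2^(ν+1+2^ν)` meet E5′'s `hsmall`, `hliplb`, `hlipb`,
`hpos` (for `ω > 0`, `τ̄ ≥ 0`) AND `μ < 1`.  Fading through E5′ is thus NOT an extra smallness beyond these two — no `L`-dependent exponent (contrast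
N2-bis `breakEven`, N2-ter §A `breakEven2`). [folklore] -/
theorem fade_sufficient_E5' {ν D : ℕ} {a'' ε' α4 τbar ω : ℝ} (hε' : 0 ≤ ε') (hα4 : 0 < α4) (hτbar : 0 ≤ τbar)
    (hω : 0 < ω)
    (hKP : 2 ^ (ν + 1) * Real.exp 1 * ((D : ℝ) + 1) * (2:ℝ) ^ (2 ^ ν) * 2 ^ (ν + 1 + 2 ^ ν) * ε' *
      Real.exp (a'' * (ν + 1)) ≤ 1)
    (hprod : 8 * Real.exp 1 * ((D : ℝ) + 1) * (2:ℝ) ^ (2 ^ ν) * (2 ^ (ν + 1 + 2 ^ ν)) ^ 2 * α4 * ε' * τbar < 1 - ω) :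
    ∃ a₁ lip lipbar : ℝ, 0 ≤ a₁ ∧ 0 < lip ∧ lip ≤ lipbar ∧ α4 * 2 ^ (ν + 1 + 2 ^ ν) ≤ lip ∧
      ((D : ℝ) + 1) * (2 * ε') * Real.exp (a'' * (ν + 1) + 2 ^ ν * (a₁ + Real.log 2)) * 2 ^ (ν + 1 + 2 ^ ν) ≤ a₁ ∧
      0 < ω + 4 * lipbar * (a₁ * Real.exp (-(a'' * (ν + 1)))) * τbar ∧
      ω + 4 * lipbar * (a₁ * Real.exp (-(a'' * (ν + 1)))) * τbar < 1 := by
  set P : ℝ := 2 ^ (ν + 1 + 2 ^ ν) with hP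
  set Q : ℝ := (2:ℝ) ^ (2 ^ ν) with hQ
  have hP0 : 0 < P := by positivity
  have hQ0 : 0 < Q := by positivity
  set a₁ : ℝ := 2 * Real.exp 1 * ((D : ℝ) + 1) * Q * P * ε' * Real.exp (a'' * (ν + 1)) with ha₁
  have ha₁0 : 0 ≤ a₁ := by positivity
  -- the envelope value
  have eB : a₁ * Real.exp (-(a'' * (ν + 1))) = 2 * Real.exp 1 * ((D : ℝ) + 1) * Q * P * ε' := by
    have : Real.exp (a'' * (ν + 1)) * Real.exp (-(a'' * (ν + 1))) = 1 := by
      rw [← Real.exp_add, add_neg_cancel, Real.exp_zero]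
    calc a₁ * Real.exp (-(a'' * (ν + 1)))
        = 2 * Real.exp 1 * ((D : ℝ) + 1) * Q * P * ε' * (Real.exp (a'' * (ν + 1)) * Real.exp (-(a'' * (ν + 1)))) := by
          rw [ha₁]; ring
      _ = 2 * Real.exp 1 * ((D : ℝ) + 1) * Q * P * ε' := by rw [this, mul_one]
  refine ⟨a₁, α4 * P, α4 * P, ha₁0, by positivity, le_rfl, le_rfl, ?_, ?_, ?_⟩
  · -- `hsmall`: `e^{2^ν a₁} ≤ e` since `2^ν·a₁ ≤ 1` by `hKP`
    have h1 : 2 ^ ν * a₁ ≤ 1 := by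
      have e1 : 2 ^ ν * a₁ =
          2 ^ (ν + 1) * Real.exp 1 * ((D : ℝ) + 1) * Q * P * ε' * Real.exp (a'' * (ν + 1)) := by
        rw [ha₁]; ring
      rw [e1]; exact hKP
    have h2 : Real.exp (a'' * (ν + 1) + 2 ^ ν * (a₁ + Real.log 2)) ≤ Real.exp (a'' * (ν + 1)) * Real.exp 1 * Q := by
      rw [show a'' * (ν + 1) + 2 ^ ν * (a₁ + Real.log 2) = a'' * (ν + 1) + 2 ^ ν * a₁ + 2 ^ ν * Real.log 2 by ring,
        Real.exp_add, Real.exp_add]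
      have hQe : Real.exp (2 ^ ν * Real.log 2) = Q := by
        have := exp_two_pow_mul_add_log_two ν 0
        rw [mul_zero, Real.exp_zero, one_mul, zero_add] at this
        rw [hQ]; exact this
      rw [hQe]
      have : Real.exp (2 ^ ν * a₁) ≤ Real.exp 1 := Real.exp_le_exp.2 h1
      have hc : 0 ≤ Real.exp (a'' * (ν + 1)) := (Real.exp_pos _).le
      calc Real.exp (a'' * (ν + 1)) * Real.exp (2 ^ ν * a₁) * Q
          ≤ Real.exp (a'' * (ν + 1)) * Real.exp 1 * Q :=
            mul_le_mul_of_nonneg_right (mul_le_mul_of_nonneg_left this hc) hQ0.le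
        _ = _ := rfl
    have hc : 0 ≤ ((D : ℝ) + 1) * (2 * ε') * P := by positivity
    calc ((D : ℝ) + 1) * (2 * ε') * Real.exp (a'' * (ν + 1) + 2 ^ ν * (a₁ + Real.log 2)) * P
        = (((D : ℝ) + 1) * (2 * ε') * P) * Real.exp (a'' * (ν + 1) + 2 ^ ν * (a₁ + Real.log 2)) := by ring
      _ ≤ (((D : ℝ) + 1) * (2 * ε') * P) * (Real.exp (a'' * (ν + 1)) * Real.exp 1 * Q) :=
          mul_le_mul_of_nonneg_left h2 hc
      _ = a₁ := by rw [ha₁]; ring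
  · -- `hpos`: `μ ≥ ω > 0` since the product is nonnegative
    rw [eB]
    have : 0 ≤ 4 * (α4 * P) * (2 * Real.exp 1 * ((D : ℝ) + 1) * Q * P * ε') * τbar := by positivity
    linarith
  · rw [eB]
    have e2 : 4 * (α4 * P) * (2 * Real.exp 1 * ((D : ℝ) + 1) * Q * P * ε') * τbar =
        8 * Real.exp 1 * ((D : ℝ) + 1) * Q * P ^ 2 * α4 * ε' * τbar := by ring
    rw [e2]
    linarith

/-! ## §3 The `fade_iff` anchor on E5′'s rate letter (reading F-ne9leaf10g2-1 of the (w6) lineage, kernel form) -/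

/-- E5′'s rate letter through `T4HistoryLipschitzSegment.fade_iff` (B := `a₁·e^{−a″(ν+1)}`), product reassociated:
`μ < 1 ↔ 4·lipbar·a₁·τ̄·e^{−a″(ν+1)} < 1 − ω`. [folklore] -/
theorem fade_iff_E5' {ν : ℕ} {ω lipbar a₁ a'' τbar : ℝ} :
    ω + 4 * lipbar * (a₁ * Real.exp (-(a'' * (ν + 1)))) * τbar < 1 ↔
      4 * lipbar * a₁ * τbar * Real.exp (-(a'' * (ν + 1))) < 1 - ω := by
  rw [fade_iff]
  have e : 4 * lipbar * (a₁ * Real.exp (-(a'' * (ν + 1)))) * τbar =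
      4 * lipbar * a₁ * τbar * Real.exp (-(a'' * (ν + 1))) := by ring
  rw [e]

/-- **FADING THROUGH E5′ IS A LOWER BOUND ON THE DECAY-WEIGHT RATE `a″`** (finding F-ne9leaf10g2-1, kernel form): for a positive
product `4·lipbar·a₁·τ̄` and `ω < 1`,  `μ < 1 ↔ log(4·lipbar·a₁·τ̄ / (1 − ω)) < a″·(ν+1)` — TYPE «κ sufficiently large» ([I] Thm 3
«κ ≥ κ₀», [II] p. 18), uniformly in everything else; at fixed `a₁` the price is paid in `hsmall` as the `ε′·e^{a″(ν+1)}`-smallness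
(§2 reads the same product at the `a₁`-floor instead). [folklore] -/
theorem fade_iff_log_lt_E5' {ν : ℕ} {ω lipbar a₁ a'' τbar : ℝ} (hP : 0 < 4 * lipbar * a₁ * τbar) (hω : ω < 1) :
    ω + 4 * lipbar * (a₁ * Real.exp (-(a'' * (ν + 1)))) * τbar < 1 ↔
      Real.log (4 * lipbar * a₁ * τbar / (1 - ω)) < a'' * (ν + 1) := by
  rw [fade_iff_E5']
  have h1ω : 0 < 1 - ω := by linarith
  have hcancel : Real.exp (-(a'' * (ν + 1))) * Real.exp (a'' * (ν + 1)) = 1 := by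
    rw [← Real.exp_add, neg_add_cancel, Real.exp_zero]
  constructor
  · intro h
    have h2 : 4 * lipbar * a₁ * τbar / (1 - ω) < Real.exp (a'' * (ν + 1)) := by
      rw [div_lt_iff₀ h1ω]
      have e : 4 * lipbar * a₁ * τbar =
          4 * lipbar * a₁ * τbar * Real.exp (-(a'' * (ν + 1))) * Real.exp (a'' * (ν + 1)) := by
        rw [mul_assoc (4 * lipbar * a₁ * τbar), hcancel, mul_one]
      rw [e, mul_comm (Real.exp (a'' * (ν + 1))) (1 - ω)]
      exact mul_lt_mul_of_pos_right h (Real.exp_pos _)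
    calc Real.log (4 * lipbar * a₁ * τbar / (1 - ω)) < Real.log (Real.exp (a'' * (ν + 1))) :=
        Real.log_lt_log (div_pos hP h1ω) h2
      _ = a'' * (ν + 1) := Real.log_exp _
  · intro h
    have h2 : 4 * lipbar * a₁ * τbar / (1 - ω) < Real.exp (a'' * (ν + 1)) := by
      calc 4 * lipbar * a₁ * τbar / (1 - ω) = Real.exp (Real.log (4 * lipbar * a₁ * τbar / (1 - ω))) :=
          (Real.exp_log (div_pos hP h1ω)).symm
        _ < Real.exp (a'' * (ν + 1)) := Real.exp_lt_exp.2 h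
    rw [div_lt_iff₀ h1ω] at h2
    have hE : 0 < Real.exp (-(a'' * (ν + 1))) := Real.exp_pos _
    calc 4 * lipbar * a₁ * τbar * Real.exp (-(a'' * (ν + 1)))
        < Real.exp (a'' * (ν + 1)) * (1 - ω) * Real.exp (-(a'' * (ν + 1))) := mul_lt_mul_of_pos_right h2 hE
      _ = 1 - ω := by
        rw [mul_comm (Real.exp (a'' * (ν + 1))) (1 - ω), mul_assoc, mul_comm (Real.exp (a'' * (ν + 1))), hcancel,
          mul_one]

/-- **`μ` is ANTITONE in `a″`** (nonnegative product): raising the decay-weight rate only helps fading. [folklore] -/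
theorem rate_antitone_E5' {ν : ℕ} {ω lipbar a₁ τbar a'' b'' : ℝ} (hP : 0 ≤ 4 * lipbar * a₁ * τbar) (hab : a'' ≤ b'') :
    ω + 4 * lipbar * (a₁ * Real.exp (-(b'' * (ν + 1)))) * τbar ≤
      ω + 4 * lipbar * (a₁ * Real.exp (-(a'' * (ν + 1)))) * τbar := by
  have hν : (0:ℝ) ≤ (ν:ℝ) + 1 := by positivity
  have hE : Real.exp (-(b'' * (ν + 1))) ≤ Real.exp (-(a'' * (ν + 1))) :=
    Real.exp_le_exp.2 (by nlinarith [mul_le_mul_of_nonneg_right hab hν])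
  have e1 : ∀ x : ℝ, ω + 4 * lipbar * (a₁ * x) * τbar = ω + (4 * lipbar * a₁ * τbar) * x := fun x => by ring
  rw [e1, e1]
  have := mul_le_mul_of_nonneg_left hE hP
  linarith

/-- T⁴ pure numbers of §2 (ν = 4, D = 8): the KP-type constant `2^5·9·2^16·2^21 = 288·2^37`, the product constant
`8·9·2^16·2^42 = 72·2^58`, and the exponent factor `ν + 1 = 5` (print's «exp 5κ»). [folklore] -/
theorem T4_shapes_E5' :
    (2:ℝ) ^ ((4:ℕ) + 1) * (((8:ℕ) : ℝ) + 1) * (2:ℝ) ^ (2 ^ (4:ℕ)) * 2 ^ ((4:ℕ) + 1 + 2 ^ (4:ℕ)) = 288 * 2 ^ 37 ∧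
      (8:ℝ) * (((8:ℕ) : ℝ) + 1) * (2:ℝ) ^ (2 ^ (4:ℕ)) * ((2:ℝ) ^ ((4:ℕ) + 1 + 2 ^ (4:ℕ))) ^ 2 = 72 * 2 ^ 58 ∧
      (((4:ℕ) : ℝ) + 1) = 5 := by
  refine ⟨by norm_num, by norm_num, by norm_num⟩

end Summit.QuantumFields.BalabanUV.T4Continuum.NE9LinSizeEndBudget

end
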